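import Literature.NumberTheory.EllipticCurves.PAdicHeights
import Literature.NumberTheory.EllipticCurves.FormalGroup

/-!
# Sanity lemmas for the Tate-curve `q`-expansions and `unitTwo` (pub-bsdres REVIEW-RUNBOOK,
# cards `tateE4`, `tateDelta`, `WeierstrassCurve.unitTwo`)

Review evidence only (ops-runbook sanity registry `registry/pub-bsdres.json`); no new definitions.

* `tateE4 q = 1 + 240 ∑ σ₃(n) qⁿ`, `tateDelta q = q ∏ (1 − qⁿ)²⁴`, `tateJ = E₄³/Δ`
  (`Literature/NumberTheory/EllipticCurves/PAdicHeights.lean`): at `q = 0` the values are the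
  printed constant terms `E₄(0) = 1`, `Δ(0) = 0`, and `j(0)` is the documented junk value `0`
  (`E₄(0)³ / Δ(0) = 1 / 0`);
* `WeierstrassCurve.unitTwo : Aˣ` for a `ℚ`-algebra `A`
  (`Literature/NumberTheory/EllipticCurves/FormalGroup.lean`): its value is `2`, so it witnesses
  Mathlib's `IsUnit (2 : A)` ((a) agreement); the `ℚ`-algebra hypothesis is needed — `2` is not a
  unit of `ℤ` (fails-instance for the hypothesis).
-/

namespace Summit.BirchSwinnertonDyer.Rank1Residual.Runbook

open Literature.NumberTheory.EllipticCurves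

section TateSeries

variable {K : Type*} [NormedField K]

/-- `E₄(0) = 1`: the constant term of the weight-4 Eisenstein series. -/
theorem tateE4_zero : tateE4 (0 : K) = 1 := by
  simp [tateE4]

/-- `Δ(0) = 0`: the discriminant `q ∏ (1 − qⁿ)²⁴` vanishes at `q = 0` (the Tate curve degenerates). -/
theorem tateDelta_zero : tateDelta (0 : K) = 0 := by
  simp [tateDelta]

/-- `j(0) = 0` is the documented JUNK value (`1 / 0 = 0` in Lean); the honest statement is the pole
`j(q) = q⁻¹ + 744 + ⋯`, which is why the tree's uniformisation facts assume `0 < ‖q‖ < 1`. -/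
theorem tateJ_zero : tateJ (0 : K) = 0 := by
  simp [tateJ, tateDelta_zero]

end TateSeries

section UnitTwo

variable {A : Type*} [CommRing A] [Algebra ℚ A]

/-- The underlying element of `unitTwo` is `2`. -/
theorem val_unitTwo : ((WeierstrassCurve.unitTwo : Aˣ) : A) = 2 := rfl

/-- (a) agreement with Mathlib: `unitTwo` witnesses `IsUnit (2 : A)` in every `ℚ`-algebra. -/
theorem isUnit_two : IsUnit (2 : A) := ⟨WeierstrassCurve.unitTwo, rfl⟩

/-- Its inverse is `algebraMap ℚ A (1/2)`, i.e. `2 · 2⁻¹ = 1` holds in `A`. -/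
theorem two_mul_unitTwo_inv : (2 : A) * ((WeierstrassCurve.unitTwo : Aˣ)⁻¹ : Aˣ) = 1 := by
  rw [← val_unitTwo, Units.mul_inv]

/-- Fails-instance for the hypothesis: `2` is NOT a unit of `ℤ` (no `ℚ`-algebra structure) — the
`[Algebra ℚ A]` assumption of `unitTwo` (and of the formal-group `log`/`exp` it serves) is used. -/
theorem not_isUnit_two_int : ¬ IsUnit (2 : ℤ) := by
  rw [Int.isUnit_iff]
  decide

end UnitTwo

end Summit.BirchSwinnertonDyer.Rank1Residual.Runbook
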